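import Literature.NumberTheory.EllipticCurves.ZywinaCMImage
import Literature.NumberTheory.EllipticCurves.CMModPImageNotSurjectiveProofs
import Literature.NumberTheory.EllipticCurves.NonEisensteinPrimeOfSurjective
import Literature.NumberTheory.EllipticCurves.PointDivisibilityProofs
import HarnessLib

/-!
# `zywina2015_cm_modEll_not_surjective` holds: the mod-`ℓ` image of a CM elliptic curve over `ℚ`
# is never `GL₂(𝔽_ℓ)`, for EVERY odd prime `ℓ` — the discharge

Topic `NumberTheory/EllipticCurves`; theorem-only `Proofs` companion (D-0014 append protocol:
nothing is stated here as a fact, no definition, no `sorry`) of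
`Literature.NumberTheory.EllipticCurves.ZywinaCMImage`, whose named fact
`Literature.NumberTheory.EllipticCurves.zywina2015_cm_modEll_not_surjective` (D. Zywina,
arXiv:1508.07660, Prop. 1.14 and Prop. 1.16; J.-P. Serre, Invent. Math. 15 (1972) §4.5) reads:
for every elliptic curve `W/ℚ` with (geometric) complex multiplication and every prime `ℓ ≠ 2`
the mod-`ℓ` representation `ρ̄_{E,ℓ} : Γ_ℚ → Aut(E[ℓ])` is not surjective.  The tree already
proves the qualitative form "for all `ℓ` beyond a threshold"
(`exists_bound_forall_not_hasSurjectiveModNGaloisRep_of_hasCM`, through the main theorem of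
complex multiplication `cmTorsion_cartanImage_holds`); this file removes the threshold.

## The printed argument and the proof given here

Zywina's proof (§7.4, Lemma 7.2): over the CM field `k` the image `ρ̄_{E,ℓ}(Gal_k) ⊆ (R/ℓR)ˣ`
is commutative (`R = End(E_ℚ̄)` acting faithfully on `E[ℓ] ≅ R/ℓ`), so `ρ̄_{E,ℓ}(Gal_ℚ)` has an
abelian subgroup of index `≤ 2`, while `GL₂(𝔽_ℓ)` has none for `ℓ` odd; the finer conjugacy
classes (`N_s`, `N_ns`, Borel-type) are then read off.  Only NON-SURJECTIVITY is vendored, and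
for it the following shadow of the argument suffices, assembled from theorems of the tree.

Let `ψ ∈ End_{ℚ̄}(W)` be the twisted square root supplied by the CM library
(`WeierstrassCurve.exists_sq_eq_intCast_quadraticTwist_of_hasCM`, Lang, *Elliptic Functions*,
Ch. 10 §4, Remark / Silverman *AT* II.2.2): `ψ² = D ≠ 0`, `ψ(σP) = χ(σ)·σψ(P)` for the quadratic
character `χ ≠ 1` of the CM field.  Fix an odd prime `ℓ`.

* **Reduction (`exists_sqrt_twist_apply_ne_zero`).**  If `ψ` kills `W[ℓ]`, then `ψ = μ ∘ [ℓ]`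
  for an additive `μ` on `W(ℚ̄)` (`[ℓ]` is onto `W(ℚ̄)`: the tree's
  `WeierstrassCurve.zsmul_geomPoints_surjective_holds`, Silverman *AEC* III.4.2(a)/II.2.3; the
  group-theoretic shadow of *AEC* III.4.11), `ℓ² ∣ D` (Bézout on `W[ℓ] ≠ 0`), and
  `μ² = D/ℓ²`, `μ(σP) = χ(σ)·σμ(P)`.  Descending on `|D|` we may therefore assume that `ψ`
  does NOT vanish on `W[ℓ]`.  Let `φ = ψ|_{W[ℓ]}`.
* **Case `ℓ ∤ D` (Cartan normaliser; Serre 1972 §2.2/§4.5).**  `φ` is no scalar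
  (`WeierstrassCurve.geomTorsion_ne_smul_of_twist`); in a frame `W[ℓ] ≅ 𝔽_ℓ²`
  (`WeierstrassCurve.exists_frame_galoisRepTorsion_rat`) its matrix `Φ` is a non-scalar square
  root of `D ≠ 0` and every `ρ̄(σ)` commutes or anti-commutes with `Φ`
  (`exists_matrix_sqrt_frame`); the transvection `(1 1; 0 1)` does neither
  (`transvection_not_comm_not_anticomm`), so it is not in the image
  (`WeierstrassCurve.map_range_galoisRepTorsion_eq_top_iff`).
* **Case `ℓ ∣ D` (Borel).**  Then `φ² = 0` and `φ ≠ 0`, so `ker φ` is a proper non-zero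
  `Γ_ℚ`-stable subgroup of `W[ℓ]` (stability from the twist relation): `W[ℓ]` is reducible,
  whereas a surjective `ρ̄_{E,ℓ}` is irreducible
  (`hasIrreducibleModPGaloisRep_of_hasSurjectiveModNGaloisRep`).

Main results:

* `Literature.NumberTheory.EllipticCurves.zywina2015_cm_modEll_not_surjective_holds` — the
  discharge, `theorem … : zywina2015_cm_modEll_not_surjective`.
* `WeierstrassCurve.not_hasSurjectiveModNGaloisRep_of_hasCM` — the same statement with explicit
  binders, for direct use.

## References

* [Zywina2015] D. Zywina, *On the possible images of the mod ℓ representations associated to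
  elliptic curves over ℚ*, arXiv:1508.07660 (2015), §1.9 Prop. 1.14, Prop. 1.16; §7, Lemma 7.2.
* [Serre1972] J.-P. Serre, *Propriétés galoisiennes des points d'ordre fini des courbes
  elliptiques*, Invent. Math. 15 (1972) 259–331, §2.2, §4.5.
* [SilvermanAEC2009] J. H. Silverman, *The Arithmetic of Elliptic Curves*, 2nd ed. (2009),
  Prop. III.4.2(a), Cor. III.4.11, Cor. III.6.4(b).
* [Lang1987] S. Lang, *Elliptic Functions*, 2nd ed., GTM 112 (1987), Ch. 10 §4, Remark.
-/

noncomputable section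

open scoped Classical MatrixGroups
open Matrix Field

namespace WeierstrassCurve

open Literature.NumberTheory.EllipticCurves

variable (W : WeierstrassCurve ℚ) [W.IsElliptic]

/-! ### Factorisation through `[ℓ]` and the descent on `|D|` -/

/-- **An additive endomorphism of `W(ℚ̄)` killing `W[ℓ]` factors through `[ℓ]`** (the
group-theoretic shadow of Silverman, *AEC*, Cor. III.4.11 for `φ = [ℓ]`: `[ℓ] : W(ℚ̄) → W(ℚ̄)` is
onto, Prop. III.4.2(a), the tree's `WeierstrassCurve.zsmul_geomPoints_surjective_holds`, and its
kernel is `W[ℓ]`).  [cite: SilvermanAEC2009, Cor. III.4.11 and Prop. III.4.2(a)] -/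
theorem exists_apply_zsmul_eq_of_forall_geomTorsion {ℓ : ℕ} (hℓ : ℓ.Prime)
    (ψ : AddMonoid.End W.geomPoints)
    (hψ : ∀ P : W.geomPoints, P ∈ W.geomTorsion ℓ → ψ P = 0) :
    ∃ μ : AddMonoid.End W.geomPoints, ∀ P : W.geomPoints, μ ((ℓ : ℤ) • P) = ψ P := by
  have hℓ0 : (ℓ : ℤ) ≠ 0 := by exact_mod_cast hℓ.ne_zero
  set f : W.geomPoints →+ W.geomPoints := zsmulAddGroupHom (α := W.geomPoints) (ℓ : ℤ) with hf
  have hfapp : ∀ P : W.geomPoints, f P = (ℓ : ℤ) • P := fun P ↦ by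
    rw [hf, zsmulAddGroupHom_apply]
  have hsurj : Function.Surjective f := fun Q ↦ by
    obtain ⟨P, hP⟩ := W.zsmul_geomPoints_surjective_holds hℓ0 Q
    exact ⟨P, by rw [hfapp]; exact hP⟩
  have hker : f.ker ≤ (ψ : W.geomPoints →+ W.geomPoints).ker := by
    intro P hP
    rw [AddMonoidHom.mem_ker] at hP ⊢
    rw [hfapp] at hP
    exact hψ P ((Submodule.mem_torsionBy_iff (ℓ : ℤ) P).mpr hP)
  refine ⟨f.liftOfRightInverse (Function.surjInv hsurj) (Function.rightInverse_surjInv hsurj)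
    ⟨(ψ : W.geomPoints →+ W.geomPoints), hker⟩, fun P ↦ ?_⟩
  have h := f.liftOfRightInverse_comp_apply (Function.surjInv hsurj)
    (Function.rightInverse_surjInv hsurj) ⟨(ψ : W.geomPoints →+ W.geomPoints), hker⟩ P
  rw [hfapp] at h
  exact h

omit [W.IsElliptic] in
/-- Pointwise form of `ψ * ψ = D` in `AddMonoid.End W(ℚ̄)` (private plumbing). [folklore] -/
private theorem apply_apply_eq_zsmul_of_mul_self_eq_intCast {ψ : AddMonoid.End W.geomPoints} {D : ℤ}
    (hψψ : ψ * ψ = (D : AddMonoid.End W.geomPoints)) (P : W.geomPoints) : ψ (ψ P) = D • P := by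
  have := congrArg (fun f : AddMonoid.End W.geomPoints ↦ f P) hψψ
  simpa only [AddMonoid.End.coe_mul, Function.comp_apply, AddMonoid.End.intCast_apply] using this

/-- **Descent on `|D|`: a twisted square root that does not vanish on `W[ℓ]`.**  Let `ℓ` be a
prime and `ψ` an additive endomorphism of `W(ℚ̄)` with `ψ² = D ≠ 0` and
`ψ(σP) = χ(σ)·σψ(P)` (`χ : Γ_ℚ →* ℤˣ`).  Then there are `ψ'`, `D' ≠ 0` with the same two
properties and a point `P ∈ W[ℓ]` with `ψ' P ≠ 0`.  (If `ψ` kills `W[ℓ]` then `ψ = μ ∘ [ℓ]`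
by `exists_apply_zsmul_eq_of_forall_geomTorsion`; Bézout on `W[ℓ] ≠ 0`
(`geomTorsion_eq_zero_of_zsmul_eq_zero`, `exists_ne_zero_geomTorsion_prime`, *AEC* III.6.4(b))
gives `ℓ ∣ D` and then `ℓ ∣ D/ℓ`; `μ² = D/ℓ²` and `μ` is twisted by the same `χ`; induct.)
[cite: SilvermanAEC2009, Cor. III.4.11 and Cor. III.6.4(b)] -/
theorem exists_sqrt_twist_apply_ne_zero {ℓ : ℕ} (hℓ : ℓ.Prime)
    (χ : absoluteGaloisGroup ℚ →* ℤˣ) (n : ℕ) :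
    ∀ (ψ : AddMonoid.End W.geomPoints) (D : ℤ), D.natAbs ≤ n → D ≠ 0 →
      ψ * ψ = (D : AddMonoid.End W.geomPoints) →
      (∀ (σ : absoluteGaloisGroup ℚ) (P : W.geomPoints),
        ψ (σ • P) = ((χ σ : ℤˣ) : ℤ) • σ • ψ P) →
      ∃ (ψ' : AddMonoid.End W.geomPoints) (D' : ℤ), D' ≠ 0 ∧
        ψ' * ψ' = (D' : AddMonoid.End W.geomPoints) ∧
        (∀ (σ : absoluteGaloisGroup ℚ) (P : W.geomPoints),
          ψ' (σ • P) = ((χ σ : ℤˣ) : ℤ) • σ • ψ' P) ∧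
        ∃ P : W.geomPoints, P ∈ W.geomTorsion ℓ ∧ ψ' P ≠ 0 := by
  induction n with
  | zero =>
    intro ψ D hn hD
    exact absurd (Int.natAbs_eq_zero.mp (Nat.le_zero.mp hn)) hD
  | succ n ih =>
    intro ψ D hn hD hψψ hrel
    by_cases hex : ∃ P : W.geomPoints, P ∈ W.geomTorsion ℓ ∧ ψ P ≠ 0
    · exact ⟨ψ, D, hD, hψψ, hrel, hex⟩
    push Not at hex
    -- `ψ` kills `W[ℓ]`: factor `ψ = μ ∘ [ℓ]`
    have hℓ0 : (ℓ : ℤ) ≠ 0 := by exact_mod_cast hℓ.ne_zero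
    have hprime : Prime (ℓ : ℤ) := Nat.prime_iff_prime_int.mp hℓ
    obtain ⟨μ, hμ⟩ := W.exists_apply_zsmul_eq_of_forall_geomTorsion hℓ ψ hex
    have hψψP := W.apply_apply_eq_zsmul_of_mul_self_eq_intCast hψψ
    obtain ⟨Q₀, hQ₀⟩ := W.exists_ne_zero_geomTorsion_prime hℓ
    -- `ℓ ∣ D`: `D` kills `W[ℓ]`
    have hℓD : (ℓ : ℤ) ∣ D := by
      by_contra hnd
      refine hQ₀ (W.geomTorsion_eq_zero_of_zsmul_eq_zero hℓ hnd Q₀ (Subtype.ext ?_))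
      rw [AddSubgroupClass.coe_zsmul, ZeroMemClass.coe_zero, ← hψψP, hex _ Q₀.2, map_zero]
    obtain ⟨D₁, hD₁⟩ := hℓD
    -- `ℓ ∣ D₁`: `D₁` kills `W[ℓ] = [ℓ] W[ℓ²]`
    have hℓD₁ : (ℓ : ℤ) ∣ D₁ := by
      by_contra hnd
      refine hQ₀ (W.geomTorsion_eq_zero_of_zsmul_eq_zero hℓ hnd Q₀ (Subtype.ext ?_))
      obtain ⟨P, hP⟩ := W.zsmul_geomPoints_surjective_holds hℓ0 (Q₀ : W.geomPoints)
      have hP' : (ℓ : ℤ) • P = (Q₀ : W.geomPoints) := hP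
      have h1 : ψ (ψ P) = 0 := by
        rw [← hμ (ψ P), ← map_zsmul ψ, hP', hex _ Q₀.2, map_zero]
      rw [AddSubgroupClass.coe_zsmul, ZeroMemClass.coe_zero, ← hP', smul_smul, mul_comm D₁ (ℓ : ℤ),
        ← hD₁, ← hψψP, h1]
    obtain ⟨D₂, hD₂⟩ := hℓD₁
    have hD₂0 : D₂ ≠ 0 := by
      rintro rfl
      exact hD (by rw [hD₁, hD₂, mul_zero, mul_zero])
    -- `μ` is twisted by `χ`
    have hrelμ : ∀ (σ : absoluteGaloisGroup ℚ) (P : W.geomPoints),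
        μ (σ • P) = ((χ σ : ℤˣ) : ℤ) • σ • μ P := fun σ R ↦ by
      obtain ⟨P, rfl⟩ := W.zsmul_geomPoints_surjective_holds hℓ0 R
      change μ (σ • ((ℓ : ℤ) • P)) = ((χ σ : ℤˣ) : ℤ) • σ • μ ((ℓ : ℤ) • P)
      rw [smul_comm σ (ℓ : ℤ) P, hμ, hμ, hrel]
    -- `μ ∘ μ = D₂`
    have hμμ : μ * μ = (D₂ : AddMonoid.End W.geomPoints) := by
      apply DFunLike.ext
      intro R
      obtain ⟨P₁, rfl⟩ := W.zsmul_geomPoints_surjective_holds hℓ0 R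
      obtain ⟨P, rfl⟩ := W.zsmul_geomPoints_surjective_holds hℓ0 P₁
      change μ (μ ((ℓ : ℤ) • (ℓ : ℤ) • P)) = D₂ • (ℓ : ℤ) • (ℓ : ℤ) • P
      rw [hμ, map_zsmul ψ, hμ, hψψP, hD₁, hD₂, smul_smul, smul_smul]
      congr 1
      ring
    -- `|D₂| ≤ n`
    have habs : D.natAbs = ℓ * (ℓ * D₂.natAbs) := by
      rw [hD₁, hD₂, Int.natAbs_mul, Int.natAbs_mul, Int.natAbs_natCast]
    have h4 : 2 * (2 * D₂.natAbs) ≤ D.natAbs := by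
      rw [habs]
      exact Nat.mul_le_mul hℓ.two_le (Nat.mul_le_mul hℓ.two_le le_rfl)
    have hpos : 0 < D₂.natAbs := Int.natAbs_pos.mpr hD₂0
    have hle : D₂.natAbs ≤ n := by omega
    exact ih μ D₂ hle hD₂0 hμμ hrelμ

/-! ### The theorem -/

/-- **Zywina 2015, Prop. 1.14/1.16 (non-surjectivity clause); Serre 1972, §4.5.**  For every
elliptic curve `W/ℚ` with (geometric) complex multiplication and every odd prime `ℓ`, the mod-`ℓ`
Galois representation `ρ̄_{E,ℓ} : Γ_ℚ → Aut(E[ℓ])` is NOT surjective.  Proof: take the twisted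
`√D` of the CM library (`exists_sq_eq_intCast_quadraticTwist_of_hasCM`), normalised by
`exists_sqrt_twist_apply_ne_zero` so that `φ = √D|_{W[ℓ]} ≠ 0`; if `ℓ ∤ D` the image normalises
the Cartan subgroup `𝔽_ℓ[Φ]ˣ` and misses the transvection `(1 1; 0 1)` (`exists_matrix_sqrt_frame`,
`transvection_not_comm_not_anticomm`); if `ℓ ∣ D` then `ker φ` is a `Γ_ℚ`-stable line, so
`W[ℓ]` is reducible, which a surjective `ρ̄` is not
(`hasIrreducibleModPGaloisRep_of_hasSurjectiveModNGaloisRep`).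
[cite: Zywina2015, Prop. 1.14 and Prop. 1.16 (§1.9); §7 Lemma 7.2] [cite: Serre1972, §4.5] -/
theorem not_hasSurjectiveModNGaloisRep_of_hasCM (hCM : W.HasCM) {ℓ : ℕ} (hℓ : ℓ.Prime)
    (hℓ2 : ℓ ≠ 2) : ¬ W.HasSurjectiveModNGaloisRep ℓ := by
  intro hsurj
  haveI : Fact ℓ.Prime := ⟨hℓ⟩
  obtain ⟨ψ₀, -, D₀, χ, hD₀, hψψ₀, hne, hrel₀⟩ :=
    W.exists_sq_eq_intCast_quadraticTwist_of_hasCM hCM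
  obtain ⟨ψ, D, -, hψψ, hrel, P₀, hP₀, hψP₀⟩ :=
    W.exists_sqrt_twist_apply_ne_zero hℓ χ D₀.natAbs ψ₀ D₀ le_rfl hD₀.ne hψψ₀ hrel₀
  have hψψP := W.apply_apply_eq_zsmul_of_mul_self_eq_intCast hψψ
  -- the restriction `φ` of `ψ` to `W[ℓ]`
  have hmem : ∀ P : W.geomTorsion ℓ, ψ (P : W.geomPoints) ∈ W.geomTorsion ℓ := fun P ↦ by
    have hP := P.2
    rw [Submodule.mem_toAddSubgroup, Submodule.mem_torsionBy_iff] at hP ⊢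
    rw [← map_zsmul, hP, map_zero]
  let φ : AddMonoid.End (W.geomTorsion ℓ) :=
    ((ψ : W.geomPoints →+ W.geomPoints).restrict (W.geomTorsion ℓ)).codRestrict
      (W.geomTorsion ℓ) hmem
  have hφ : ∀ P : W.geomTorsion ℓ, ((φ P : W.geomTorsion ℓ) : W.geomPoints) = ψ P := fun P ↦ rfl
  have hφφ : ∀ P : W.geomTorsion ℓ, φ (φ P) = D • P := fun P ↦ Subtype.ext (by
    rw [hφ, hφ, hψψP, AddSubgroupClass.coe_zsmul])
  have htw : ∀ (σ : absoluteGaloisGroup ℚ) (P : W.geomTorsion ℓ),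
      φ (σ • P) = ((χ σ : ℤˣ) : ℤ) • σ • φ P := fun σ P ↦ Subtype.ext (by
    rw [hφ, AddSubgroup.torsionBy.coe_smul, hrel, AddSubgroupClass.coe_zsmul,
      AddSubgroup.torsionBy.coe_smul, hφ])
  have hφP₀ : φ ⟨P₀, hP₀⟩ ≠ 0 := fun h ↦ hψP₀ (by
    rw [← hφ ⟨P₀, hP₀⟩, h, ZeroMemClass.coe_zero])
  by_cases hℓD : (ℓ : ℤ) ∣ D
  · /- Borel case: `φ² = 0`, `φ ≠ 0`, so `ker φ` is a `Γ_ℚ`-stable line and `W[ℓ]` is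
    reducible; but a surjective `ρ̄` is irreducible. -/
    haveI : NeZero (ℓ : ℚ) := ⟨by exact_mod_cast hℓ.ne_zero⟩
    have hirr := hasIrreducibleModPGaloisRep_of_hasSurjectiveModNGaloisRep W ℓ hsurj
    have hφφ0 : ∀ P : W.geomTorsion ℓ, φ (φ P) = 0 := fun P ↦ by
      obtain ⟨k, hk⟩ := hℓD
      rw [hφφ, hk, mul_comm, mul_zsmul, natCast_zsmul, AddSubgroup.torsionBy.nsmul, zsmul_zero]
    set H : AddSubgroup (W.geomTorsion ℓ) := (φ : W.geomTorsion ℓ →+ W.geomTorsion ℓ).ker with hH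
    have hHmem : ∀ P : W.geomTorsion ℓ, P ∈ H ↔ φ P = 0 := fun P ↦ by
      rw [hH, AddMonoidHom.mem_ker]
      rfl
    have hHstab : ∀ σ : absoluteGaloisGroup ℚ, ∀ P ∈ H, σ • P ∈ H := fun σ P hP ↦ by
      rw [hHmem] at hP ⊢
      rw [htw, hP, smul_zero, zsmul_zero]
    rcases hirr H hHstab with hbot | htop
    · have hK : φ ⟨P₀, hP₀⟩ ∈ H := (hHmem _).mpr (hφφ0 _)
      rw [hbot, AddSubgroup.mem_bot] at hK
      exact hφP₀ hK
    · have hK : (⟨P₀, hP₀⟩ : W.geomTorsion ℓ) ∈ H := by rw [htop]; exact AddSubgroup.mem_top _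
      exact hφP₀ ((hHmem _).mp hK)
  · /- Cartan case: the image commutes or anti-commutes with the non-scalar `Φ = √D`, `D ≠ 0`,
    so it misses the transvection `(1 1; 0 1)`. -/
    have h2 : (2 : ZMod ℓ) ≠ 0 := by
      intro h0
      have : ℓ ∣ 2 := (ZMod.natCast_eq_zero_iff 2 ℓ).mp (by exact_mod_cast h0)
      exact hℓ2 ((Nat.prime_dvd_prime_iff_eq hℓ Nat.prime_two).mp this)
    obtain ⟨σ₀, hσ₀⟩ := hne
    have hσ₀' : χ σ₀ = -1 := (Int.units_eq_one_or (χ σ₀)).resolve_left hσ₀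
    have hanti : ∀ P : W.geomTorsion ℓ, φ (σ₀ • P) = -(σ₀ • φ P) := fun P ↦ by
      rw [htw, hσ₀', Units.val_neg, Units.val_one, neg_one_zsmul]
    have hns : ∀ c : ℤ, ∃ P : W.geomTorsion ℓ, φ P ≠ c • P :=
      fun c ↦ W.geomTorsion_ne_smul_of_twist hℓ hℓ2 hℓD φ hφφ hanti c
    obtain ⟨e, Φfr, he, -, -, -, -⟩ := exists_frame_galoisRepTorsion_rat W ℓ
    obtain ⟨Φ, -, hΦsq, hΦns, hdich⟩ := exists_matrix_sqrt_frame W ℓ e Φfr he hφφ hns htw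
    have hD' : ((D : ℤ) : ZMod ℓ) ≠ 0 := by
      rwa [Ne, ZMod.intCast_zmod_eq_zero_iff_dvd]
    obtain ⟨hc, ha⟩ := transvection_not_comm_not_anticomm h2 hΦsq hD' hΦns
    have hdetT : Matrix.det !![(1 : ZMod ℓ), 1; 0, 1] ≠ 0 := by
      simp [Matrix.det_fin_two]
    set T : GL (Fin 2) (ZMod ℓ) := Matrix.GeneralLinearGroup.mkOfDetNeZero _ hdetT with hT
    have hTmem : T ∈ (galoisRepTorsion W ℓ).range.map Φfr.toMonoidHom := by
      rw [(map_range_galoisRepTorsion_eq_top_iff W ℓ Φfr).mpr hsurj]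
      exact Subgroup.mem_top T
    obtain ⟨σ, hσ⟩ := (mem_map_range_galoisRepTorsion_iff W ℓ Φfr).mp hTmem
    have hTval : ((Φfr (galoisRepTorsion W ℓ σ) : GL (Fin 2) (ZMod ℓ)) :
        Matrix (Fin 2) (Fin 2) (ZMod ℓ)) = !![(1 : ZMod ℓ), 1; 0, 1] := by
      rw [hσ, hT]
      rfl
    rcases hdich σ with ⟨h, -⟩ | ⟨h, -⟩
    · exact hc (by rwa [hTval] at h)
    · exact ha (by rwa [hTval] at h)

end WeierstrassCurve

namespace Literature.NumberTheory.EllipticCurves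

open _root_.WeierstrassCurve

/-- **Discharge of `zywina2015_cm_modEll_not_surjective`** (Zywina 2015, Prop. 1.14 and 1.16, in
the vendored basis-free form: for every elliptic `W/ℚ` with geometric CM and every prime `ℓ ≠ 2`,
`ρ̄_{E,ℓ} : Γ_ℚ → Aut(E[ℓ])` is not surjective) — `WeierstrassCurve.not_hasSurjectiveModNGaloisRep_of_hasCM`.
Users holding `(h : zywina2015_cm_modEll_not_surjective)` are fed this theorem.
[cite: Zywina2015, Prop. 1.14 and Prop. 1.16 (§1.9)] [cite: Serre1972, §4.5] -/
theorem zywina2015_cm_modEll_not_surjective_holds : zywina2015_cm_modEll_not_surjective := by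
  intro W _ hCM ℓ hℓ hℓ2
  exact W.not_hasSurjectiveModNGaloisRep_of_hasCM hCM hℓ hℓ2

/-- **Every prime works in `exists_bound_forall_not_hasSurjectiveModNGaloisRep_of_hasCM`**: the
threshold form of `CMModPImageNotSurjectiveProofs` with the explicit bound `L₀ = 2`.
[cite: Zywina2015, Prop. 1.14 and Prop. 1.16 (§1.9)] -/
theorem forall_not_hasSurjectiveModNGaloisRep_of_hasCM_of_two_lt (W : WeierstrassCurve ℚ)
    [W.IsElliptic] (hCM : W.HasCM) {ℓ : ℕ} (hℓ : ℓ.Prime) (h2 : 2 < ℓ) :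
    ¬ W.HasSurjectiveModNGaloisRep ℓ :=
  W.not_hasSurjectiveModNGaloisRep_of_hasCM hCM hℓ (by omega)

end Literature.NumberTheory.EllipticCurves

end
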